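import Summits.HubbardSuperconductivity.HubbardSuperconductivity.Theorems.AnisotropyChordTransferFsumBond
import Summits.HubbardSuperconductivity.HubbardSuperconductivity.Theorems.AnisotropyChordTransferCompressibilityBEC
import Summits.HubbardSuperconductivity.HubbardSuperconductivity.Theorems.AnisotropyChordTransferLadderBound

/-!
# Route `AnisotropyChord` / H0 rotor rung, route (1): the TWO-SIDED f-SUM LAW `fsumC ≍ h₀` and FEYNMAN–BIJL NECESSITY for the
# full-gap form (theory seat `hubbard-h0-rotor-theory-1` g12, memo ROTOR-THEORY-12 §184(a) «NECESSITY»; critic-4 g9 P1 «hyperuniformity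
# is necessary for the R-route (SectorGapAtLeast), not for (H2) literally»; prover seat `hubbard-h0-rotor-p1` g15)

With `fsumC_eq_bond_sum` (`fsumC = ⅛ Σ_{x∼y}(c_x − c_y)² hopCorr a x y`) and the one-bond constant `h₀ = hopCorr a 0 e₀`:

* `hopCorr_le_one` — `hopCorr a x y ≤ 1` for a unit amplitude (AM–GM + relabelling);
* `siteCos_sub_sq_le_of_adj` — `(c_x − c_y)² ≤ 2(1 − cos(2π/L))` on every bond (torus degree `≤ 4` = tree `torus_degree_le_four`);
* **`fsumC_le`** — `fsumC L Δ M a ≤ L²(1 − cos(2π/L))·h₀ ≤ 2π² h₀ ≤ 2π²` for every Perron sector amplitude, every `Δ`, `L ≥ 2`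
  (with `hopCorr_le_fsumC`: `h₀ ≤ fsumC ≤ 2π² h₀` for `L ≥ 3` — the f-sum IS the exchange correlation up to constants);
* **`gap_le_feynmanBijl`** — FEYNMAN–BIJL: `SectorGapAtLeast L Δ M g` ⇒ `g ≤ fsumC/strucC` (test state `c a/‖c a‖`, orthogonal to `a` by the
  landed `strucMean_eq_zero_of_perron`);
* **`strucC_le_of_sectorGapAtLeast`** — NECESSITY: a full sector gap `g > 0` forces `|V|·S(k₁) = strucC ≤ fsumC/g ≤ 2π²/g`, i.e. with
  `g = c/L` the sector ground states are hyperuniform, `S(k₁) = O(1/L)` (for the R-route `SectorGapAtLeast`; NOT claimed for (H2)).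

All folklore (Bijl 1940 / Feynman 1954 / Pitaevskii–Stringari 1991; Stringari 1995 eqs. (10), (15), (16)).
-/

set_option linter.dupNamespace false
set_option autoImplicit false

noncomputable section

open Finset Filter Topology
open Literature.MathematicalPhysics.QuantumLattice Literature.Probability.LatticeModels
open Summit.HubbardSuperconductivity.HubbardSuperconductivity.Theorems.AnisotropyChord.InsertionEntropy
open Summit.HubbardSuperconductivity.HubbardSuperconductivity.Theorems.AnisotropyChord.Tower

namespace Summit.HubbardSuperconductivity.HubbardSuperconductivity.Theorems.AnisotropyChord.Transfer

section General

variable {V : Type} [Fintype V] [DecidableEq V]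

/-- `hopCorr a x y ≤ Σ a²` (AM–GM on each term, `Σ_σ a(σ ∘ swap)² = Σ_σ a(σ)²`). [folklore] -/
theorem hopCorr_le_sum_sq (a : (V → Fin 2) → ℝ) (x y : V) : hopCorr a x y ≤ ∑ σ, a σ ^ 2 := by
  unfold hopCorr
  have hre : ∑ σ : V → Fin 2, a (σ ∘ ⇑(Equiv.swap x y)) ^ 2 = ∑ σ, a σ ^ 2 := by
    have hinv : ∀ σ : V → Fin 2, (σ ∘ ⇑(Equiv.swap x y)) ∘ ⇑(Equiv.swap x y) = σ := by
      intro σ; funext z; simp [Equiv.swap_apply_self]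
    have hbij : Function.Bijective (fun σ : V → Fin 2 => σ ∘ ⇑(Equiv.swap x y)) :=
      ⟨fun σ τ h => by simpa [hinv] using congrArg (fun ν => ν ∘ ⇑(Equiv.swap x y)) h, fun τ => ⟨_, hinv τ⟩⟩
    exact hbij.sum_comp (fun τ => a τ ^ 2)
  have hpt : ∀ σ : V → Fin 2, brk σ x y * (a σ * a (σ ∘ ⇑(Equiv.swap x y)))
      ≤ (a σ ^ 2 + a (σ ∘ ⇑(Equiv.swap x y)) ^ 2) / 2 := by
    intro σ
    have h0 := brk_nonneg σ x y
    have h1 := brk_le_one σ x y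
    by_cases hp : 0 ≤ a σ * a (σ ∘ ⇑(Equiv.swap x y))
    · nlinarith [sq_nonneg (a σ - a (σ ∘ ⇑(Equiv.swap x y)))]
    · push Not at hp
      nlinarith [sq_nonneg (a σ + a (σ ∘ ⇑(Equiv.swap x y)))]
  calc ∑ σ, brk σ x y * (a σ * a (σ ∘ ⇑(Equiv.swap x y)))
      ≤ ∑ σ : V → Fin 2, (a σ ^ 2 + a (σ ∘ ⇑(Equiv.swap x y)) ^ 2) / 2 := Finset.sum_le_sum fun σ _ => hpt σ
    _ = ∑ σ, a σ ^ 2 := by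
        rw [← Finset.sum_div, Finset.sum_add_distrib, hre]; ring

end General

section Torus

variable {L : ℕ} [NeZero L]

/-- `hopCorr ≤ 1` for a Perron (unit) amplitude. [folklore] -/
theorem hopCorr_le_one {Δ M : ℝ} {a : TensorIndex (TorusSite 2 L) 2 → ℝ}
    (ha : IsPerronSectorGroundAmplitude L Δ M a) (x y : TorusSite 2 L) : hopCorr a x y ≤ 1 := by
  have := hopCorr_le_sum_sq a x y; rwa [ha.unit] at this

/-- the density wave changes by at most `√(2(1 − cos(2π/L)))` across a bond: `(c_x − c_{x+eᵢ})² ≤ 2(1 − cos(2π/L))`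
(equality for `i = 0`, zero for `i = 1`). [folklore] -/
theorem siteCos_sub_sq_le_single (hL : 2 ≤ L) (x : TorusSite 2 L) (i : Fin 2) :
    (siteCos L x - siteCos L (x + Pi.single i 1)) ^ 2 ≤ 2 * (1 - Real.cos (2 * Real.pi / (L : ℝ))) := by
  set e₀ : TorusSite 2 L := Pi.single 0 1 with he
  set ω : ℂ := torusChar e₀ (Pi.single i 1) with hω
  have hχ : siteCos L x - siteCos L (x + Pi.single i 1) = (torusChar e₀ x * (1 - ω)).re := by
    rw [siteCos_eq_re hL, siteCos_eq_re hL, torusChar_add_right, mul_sub, mul_one, Complex.sub_re]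
  have hnormχ : Complex.normSq (torusChar e₀ x) = 1 := normSq_torusChar e₀ x
  have hnormω : Complex.normSq ω = 1 := normSq_torusChar e₀ _
  -- `(Re w)² ≤ |w|²`
  have hre_le : (torusChar e₀ x * (1 - ω)).re ^ 2 ≤ Complex.normSq (torusChar e₀ x * (1 - ω)) := by
    rw [Complex.normSq_apply]; nlinarith [sq_nonneg (torusChar e₀ x * (1 - ω)).im]
  have hns : Complex.normSq (torusChar e₀ x * (1 - ω)) = 2 * (1 - ω.re) := by
    rw [Complex.normSq_mul, hnormχ, one_mul, Complex.normSq_sub, Complex.normSq_one, hnormω, one_mul, Complex.conj_re]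
    ring
  -- `Re ω ≥ cos(2π/L)` in both directions
  have hωre : Real.cos (2 * Real.pi / (L : ℝ)) ≤ ω.re := by
    rw [hω, ← siteCos_eq_re hL]
    unfold siteCos
    haveI : Fact (1 < L) := ⟨hL⟩
    rcases Stiffness.Doob.fin2_eq_zero_or_one i with rfl | rfl
    · rw [Pi.single_eq_same, ZMod.val_one]; push_cast; rw [mul_one]
    · rw [Pi.single_eq_of_ne (by decide : (0 : Fin 2) ≠ 1), ZMod.val_zero]
      push_cast
      rw [mul_zero, zero_div, Real.cos_zero]
      exact Real.cos_le_one _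
  rw [hχ]
  calc (torusChar e₀ x * (1 - ω)).re ^ 2 ≤ Complex.normSq (torusChar e₀ x * (1 - ω)) := hre_le
    _ = 2 * (1 - ω.re) := hns
    _ ≤ 2 * (1 - Real.cos (2 * Real.pi / (L : ℝ))) := by linarith

/-- … hence on every bond of the torus. [folklore] -/
theorem siteCos_sub_sq_le_of_adj (hL : 2 ≤ L) {x y : TorusSite 2 L} (hxy : (torusGraph 2 L).Adj x y) :
    (siteCos L x - siteCos L y) ^ 2 ≤ 2 * (1 - Real.cos (2 * Real.pi / (L : ℝ))) := by
  obtain ⟨-, ⟨i, hi⟩ | ⟨i, hi⟩⟩ := (torusGraph_adj_iff x y).1 hxy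
  · rw [hi]; exact siteCos_sub_sq_le_single hL x i
  · rw [hi, show (siteCos L (y + Pi.single i 1) - siteCos L y) ^ 2 = (siteCos L y - siteCos L (y + Pi.single i 1)) ^ 2 by ring]
    exact siteCos_sub_sq_le_single hL y i

/-- `0 ≤ fsumC` for a Perron amplitude (all bond terms are non-negative). [folklore] -/
theorem fsumC_nonneg {Δ M : ℝ} {a : TensorIndex (TorusSite 2 L) 2 → ℝ} (ha : IsPerronSectorGroundAmplitude L Δ M a) :
    0 ≤ fsumC L Δ M a := by
  rw [fsumC_eq_bond_sum ha]
  refine mul_nonneg (by norm_num) (Finset.sum_nonneg fun x _ => Finset.sum_nonneg fun y _ => ?_)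
  split_ifs
  · exact mul_nonneg (sq_nonneg _) (hopCorr_nonneg ha.nonneg _ _)
  · exact le_rfl

/-- **f-SUM UPPER BOUND:** `fsumC L Δ M a ≤ L²(1 − cos(2π/L))·h₀` for every Perron sector amplitude (`L ≥ 2`, any `Δ`), `h₀ = hopCorr a 0 e₀`
(each bond term `≤ 2(1 − cos(2π/L))·h₀`, at most `4|V|` directed bonds, `|V| = L²`). [folklore: lattice f-sum rule] -/
theorem fsumC_le {Δ M : ℝ} {a : TensorIndex (TorusSite 2 L) 2 → ℝ} (ha : IsPerronSectorGroundAmplitude L Δ M a) (hL : 2 ≤ L) :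
    fsumC L Δ M a ≤ ((L : ℝ) ^ 2) * (1 - Real.cos (2 * Real.pi / (L : ℝ))) * hopCorr a 0 (Pi.single 0 1) := by
  set h₀ := hopCorr a 0 (Pi.single 0 1) with hh₀
  set κ : ℝ := 2 * (1 - Real.cos (2 * Real.pi / (L : ℝ))) with hκ
  have h0nn : 0 ≤ h₀ := hopCorr_nonneg ha.nonneg _ _
  have hκ0 : 0 ≤ κ := by rw [hκ]; nlinarith [Real.cos_le_one (2 * Real.pi / (L : ℝ))]
  rw [fsumC_eq_bond_sum ha]
  have hterm : ∀ x y : TorusSite 2 L,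
      (if (torusGraph 2 L).Adj x y then (siteCos L x - siteCos L y) ^ 2 * hopCorr a x y else 0)
        ≤ (if (torusGraph 2 L).Adj x y then (1:ℝ) else 0) * (κ * h₀) := by
    intro x y
    by_cases hxy : (torusGraph 2 L).Adj x y
    · rw [if_pos hxy, if_pos hxy, one_mul, hopCorr_perron_adj ha hxy, ← hh₀]
      exact mul_le_mul_of_nonneg_right (siteCos_sub_sq_le_of_adj hL hxy) h0nn
    · rw [if_neg hxy, if_neg hxy, zero_mul]
  have hsum : (∑ x : TorusSite 2 L, ∑ y,
      if (torusGraph 2 L).Adj x y then (siteCos L x - siteCos L y) ^ 2 * hopCorr a x y else 0)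
        ≤ ∑ x : TorusSite 2 L, 4 * (κ * h₀) := by
    refine Finset.sum_le_sum fun x _ => ?_
    calc (∑ y, if (torusGraph 2 L).Adj x y then (siteCos L x - siteCos L y) ^ 2 * hopCorr a x y else 0)
        ≤ ∑ y, (if (torusGraph 2 L).Adj x y then (1:ℝ) else 0) * (κ * h₀) := Finset.sum_le_sum fun y _ => hterm x y
      _ = (∑ y, if (torusGraph 2 L).Adj x y then (1:ℝ) else 0) * (κ * h₀) := by rw [Finset.sum_mul]
      _ ≤ 4 * (κ * h₀) := mul_le_mul_of_nonneg_right (torus_degree_le_four x) (mul_nonneg hκ0 h0nn)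
  rw [Finset.sum_const, Finset.card_univ, nsmul_eq_mul] at hsum
  have hcard : (Fintype.card (TorusSite 2 L) : ℝ) = (L : ℝ) ^ 2 := by
    rw [Fintype.card_fun, ZMod.card, Fintype.card_fin]; push_cast; ring
  rw [hcard] at hsum
  calc (1/8 : ℝ) * ∑ x : TorusSite 2 L, ∑ y,
        (if (torusGraph 2 L).Adj x y then (siteCos L x - siteCos L y) ^ 2 * hopCorr a x y else 0)
      ≤ (1/8 : ℝ) * ((L : ℝ) ^ 2 * (4 * (κ * h₀))) := mul_le_mul_of_nonneg_left hsum (by norm_num)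
    _ = ((L : ℝ) ^ 2) * (1 - Real.cos (2 * Real.pi / (L : ℝ))) * h₀ := by rw [hκ]; ring

omit [NeZero L] in
/-- `L²(1 − cos(2π/L)) ≤ 2π²` (`1 − cos t ≤ t²/2`). [folklore] -/
theorem sq_mul_one_sub_cos_le (hL : 1 ≤ L) :
    ((L : ℝ) ^ 2) * (1 - Real.cos (2 * Real.pi / (L : ℝ))) ≤ 2 * Real.pi ^ 2 := by
  have hLpos : (0 : ℝ) < L := by exact_mod_cast hL
  have h := Real.one_sub_sq_div_two_le_cos (x := 2 * Real.pi / (L : ℝ))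
  have ht : 2 * Real.pi / (L : ℝ) * L = 2 * Real.pi := div_mul_cancel₀ _ hLpos.ne'
  calc ((L : ℝ) ^ 2) * (1 - Real.cos (2 * Real.pi / (L : ℝ)))
      ≤ ((L : ℝ) ^ 2) * ((2 * Real.pi / (L : ℝ)) ^ 2 / 2) := mul_le_mul_of_nonneg_left (by linarith) (sq_nonneg _)
    _ = (2 * Real.pi / (L : ℝ) * L) ^ 2 / 2 := by ring
    _ = 2 * Real.pi ^ 2 := by rw [ht]; ring

/-- **`fsumC ≤ 2π² h₀ ≤ 2π²`**: the f-sum of a Perron sector amplitude is `O(1)` uniformly in `L`, `Δ`, `M`; with `hopCorr_le_fsumC`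
(`h₀ ≤ fsumC`, `L ≥ 3`) the f-sum IS the exchange correlation up to the constants `1` and `2π²`. [folklore] -/
theorem fsumC_le_two_pi_sq_mul {Δ M : ℝ} {a : TensorIndex (TorusSite 2 L) 2 → ℝ}
    (ha : IsPerronSectorGroundAmplitude L Δ M a) (hL : 2 ≤ L) :
    fsumC L Δ M a ≤ 2 * Real.pi ^ 2 * hopCorr a 0 (Pi.single 0 1) :=
  le_trans (fsumC_le ha hL)
    (mul_le_mul_of_nonneg_right (sq_mul_one_sub_cos_le (le_trans (by norm_num) hL)) (hopCorr_nonneg ha.nonneg _ _))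

/-- `fsumC ≤ 2π²`. [folklore] -/
theorem fsumC_le_two_pi_sq {Δ M : ℝ} {a : TensorIndex (TorusSite 2 L) 2 → ℝ}
    (ha : IsPerronSectorGroundAmplitude L Δ M a) (hL : 2 ≤ L) : fsumC L Δ M a ≤ 2 * Real.pi ^ 2 := by
  have h := fsumC_le_two_pi_sq_mul ha hL
  have h1 := hopCorr_le_one ha 0 (Pi.single 0 1)
  nlinarith [Real.pi_pos]

/-- **FEYNMAN–BIJL:** a full sector gap `g` in Temple form is at most the single-mode quotient `fsumC/strucC = f(k₁)/S(k₁)`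
(test state `c a/‖c a‖`, in the sector, orthogonal to `a` since `⟨a, c a⟩ = 0` for the translation-invariant Perron amplitude).
[folklore: Bijl 1940, Feynman 1954; Stringari 1995 eq. (16)] -/
theorem gap_le_feynmanBijl {Δ M g : ℝ} {a : TensorIndex (TorusSite 2 L) 2 → ℝ} (hG : SectorGapAtLeast L Δ M g)
    (ha : IsPerronSectorGroundAmplitude L Δ M a) (hL : 2 ≤ L) (hS : 0 < strucC L a) :
    g ≤ fsumC L Δ M a / strucC L a := by
  set S := strucC L a with hSdef
  set s : ℝ := (Real.sqrt S)⁻¹ with hs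
  have hs2 : s ^ 2 * S = 1 := by rw [hs, inv_pow, Real.sq_sqrt hS.le, inv_mul_cancel₀ hS.ne']
  set φ : TensorIndex (TorusSite 2 L) 2 → ℝ := s • feynmanVec L a with hφ
  have hφσ : ∀ σ, φ σ = s * feynmanVec L a σ := fun σ => rfl
  have hmem := feynmanVec_smul_mem ha.sector s
  have hunit : ∑ σ, φ σ ^ 2 = 1 := by
    simp only [hφσ, mul_pow]; rw [← Finset.mul_sum]; exact hs2
  have horth : ∑ σ, a σ * φ σ = 0 := by
    simp only [hφσ]
    have e : ∑ σ, a σ * (s * feynmanVec L a σ) = s * ∑ σ, a σ * feynmanVec L a σ := by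
      rw [Finset.mul_sum]; refine Finset.sum_congr rfl fun σ _ => by ring
    rw [e, strucMean_eq_zero_of_perron ha hL, mul_zero]
  have h := hG a φ ha hmem hunit
  rw [horth] at h
  have henergy : energyQ L Δ φ = s ^ 2 * energyQ L Δ (feynmanVec L a) := by rw [hφ, energyQ_smul]
  have hfs : energyQ L Δ (feynmanVec L a) = fsumC L Δ M a + sectorE L Δ M * S := by
    rw [hSdef]; unfold fsumC; ring
  rw [henergy, hfs] at h
  have e2 : s ^ 2 * (fsumC L Δ M a + sectorE L Δ M * S) - sectorE L Δ M = fsumC L Δ M a / S := by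
    rw [eq_div_iff hS.ne']
    calc (s ^ 2 * (fsumC L Δ M a + sectorE L Δ M * S) - sectorE L Δ M) * S
        = fsumC L Δ M a * (s ^ 2 * S) + sectorE L Δ M * S * (s ^ 2 * S) - sectorE L Δ M * S := by ring
      _ = fsumC L Δ M a := by rw [hs2]; ring
  rw [e2] at h
  simpa using h

/-- **NECESSITY for the full-gap form (R-route):** a sector gap `g > 0` forces `strucC a = |V|·S(k₁) ≤ fsumC/g`; with `fsumC ≤ 2π²`
the sector ground states along a gap `g = c/L` are hyperuniform, `S(k₁) ≤ 2π²L/(c|V|) = O(1/L)`.  (Feynman–Bijl read backwards;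
critic-4 g9 P1: a statement about `SectorGapAtLeast`, NOT about the translation-invariant (H2).) [folklore] -/
theorem strucC_le_of_sectorGapAtLeast {Δ M g : ℝ} {a : TensorIndex (TorusSite 2 L) 2 → ℝ} (hG : SectorGapAtLeast L Δ M g)
    (ha : IsPerronSectorGroundAmplitude L Δ M a) (hL : 2 ≤ L) (hg : 0 < g) :
    strucC L a ≤ fsumC L Δ M a / g := by
  have hS0 : 0 ≤ strucC L a := Finset.sum_nonneg fun σ _ => sq_nonneg _
  rcases eq_or_lt_of_le hS0 with hz | hpos
  · rw [← hz]; exact div_nonneg (fsumC_nonneg ha) hg.le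
  · have h := gap_le_feynmanBijl hG ha hL hpos
    rw [le_div_iff₀ hpos] at h
    rw [le_div_iff₀ hg]
    linarith

/-- **… quantitatively: `|V|·S(k₁) ≤ 2π²/g`.** [folklore] -/
theorem strucC_le_two_pi_sq_div {Δ M g : ℝ} {a : TensorIndex (TorusSite 2 L) 2 → ℝ} (hG : SectorGapAtLeast L Δ M g)
    (ha : IsPerronSectorGroundAmplitude L Δ M a) (hL : 2 ≤ L) (hg : 0 < g) :
    strucC L a ≤ 2 * Real.pi ^ 2 / g :=
  le_trans (strucC_le_of_sectorGapAtLeast hG ha hL hg) (div_le_div_of_nonneg_right (fsumC_le_two_pi_sq ha hL) hg.le)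

end Torus

/-! ## Feynman–Bijl pins the saturation constant of HYPOTHESIS R (appended, prover seat g15) -/

section Saturation

variable {L : ℕ} [NeZero L]

/-- **R's constant is at most `1`:** if HYPOTHESIS R (`PhononSaturationBelow L Δ M cs`: the FULL sector gap is `≥ cs·fsumC/strucC`
in Temple form over ALL sector test amplitudes) holds in a sector carrying a Perron amplitude with `fsumC > 0` (`L ≥ 2`), then
`cs ≤ 1` — test the Feynman state `c a/‖c a‖` itself (overlap `0`, excess `fsumC/strucC`).  No such cap follows for the `k = 0` form
R₀ (`PhononSaturationBelowSym`): the Feynman state has momentum `k₁` and is not an admissible (translation-invariant) test amplitude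
there (theory seat: `g_sym/FB ≈ 1.6` at `4×4`). [folklore: Feynman–Bijl] -/
theorem satConst_le_one_of_phononSaturationBelow {Δ M cs : ℝ} (hR : PhononSaturationBelow L Δ M cs)
    {a : TensorIndex (TorusSite 2 L) 2 → ℝ} (ha : IsPerronSectorGroundAmplitude L Δ M a) (hL : 2 ≤ L)
    (hF : 0 < fsumC L Δ M a) : cs ≤ 1 := by
  obtain ⟨hS, hRφ⟩ := hR a ha
  -- R is a `SectorGapAtLeast` with `g = cs · fsumC/strucC`
  have hG : SectorGapAtLeast L Δ M (cs * (fsumC L Δ M a / strucC L a)) := by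
    intro a' φ ha' hφ hφ1
    have e : a' = a := perron_eq ha' ha
    subst e
    exact hRφ φ hφ hφ1
  have h := gap_le_feynmanBijl hG ha hL hS
  have hq : 0 < fsumC L Δ M a / strucC L a := div_pos hF hS
  by_contra hc
  push Not at hc
  have : fsumC L Δ M a / strucC L a < cs * (fsumC L Δ M a / strucC L a) := by nlinarith
  linarith

end Saturation

end Summit.HubbardSuperconductivity.HubbardSuperconductivity.Theorems.AnisotropyChord.Transfer
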